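import Summits.MatrixMultiplication.MatrixMultiplication.Theorems.SoloBlindConjETwoLemmas

/-!
# Conjecture E at corank two: the branch `|A₀| ≥ 2`

Setting of `SoloBlindConjETwo` (`G` of exponent `3`, `B` sum-distinct, `S = B ∪ {p, q}`, `a = h p`, `b = h q`,
`h` zero-sum free on `S`, `τ` H-good on `S`; `A₀, A₁, A₂, A₃ ⊆ B` the unique representations of
`τ, τ-a, τ-b, τ-a-b` when present).  After the two deletions the claim `E(τ; S) ≤ 1/2` reads
`K_B(τ) + K_B(τ-a)/2 + K_B(τ-b)/2 + K_B(τ-a-b)/4 ≤ 1/2`.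

* `soloBlind_reps_meet_p/_q/_pq/_12` — H-goodness: the representations `A₀, A₁+p, A₂+q, A₃+p+q` of `τ`
  pairwise intersect inside `B`.
* `soloBlind_conjE_corank_two_main` — the inequality in the branch where `A₀` is present with `|A₀| ≥ 2`:
  kills `K-a` (`A₁ = A₂ = {s}`), `K-b`/`K-b'` (`A₀ = {s, v}`, `A₁ = {s}` resp. `A₂ = {s}`, `A₃` absent),
  `K-c`/`K-c'` (same with `A₃` present and the other one absent), and the four-representation rigidity when all of
  `A₁, A₂, A₃` are present (`|A₀| ≥ 3, |A₁|, |A₂| ≥ 2, |A₃| ≥ 1`); every other pattern is light.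
-/

namespace Summit.MatrixMultiplication.MatrixMultiplication.Theorems

open Finset

universe u

variable {ι : Type*} [DecidableEq ι]
variable {G : Type u} [AddCommGroup G] [DecidableEq G]

/-- Representations of `τ` and of `τ - h x` (`x` outside `B`) meet, for H-good `τ`. -/
theorem soloBlind_reps_meet_one {h : ι → G} {S B : Finset ι} {τ : G} (hgood : ∀ T ⊆ S, ∑ i ∈ T, h i ≠ τ + τ)
    (hBS : B ⊆ S) {x : ι} (hxS : x ∈ S) (hxB : x ∉ B) {A₀ A₁ : Finset ι}
    (hA₀ : A₀ ∈ soloBlindSeqRepAll h B τ) (hA₁ : A₁ ∈ soloBlindSeqRepAll h B (τ - h x)) :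
    ∃ s ∈ A₀, s ∈ A₁ := by
  obtain ⟨hA₀B, hA₀s⟩ := soloBlind_mem_seqRepAll.mp hA₀
  obtain ⟨hA₁B, hA₁s⟩ := soloBlind_mem_seqRepAll.mp hA₁
  by_contra hne
  push Not at hne
  have hd : Disjoint A₀ A₁ := Finset.disjoint_left.mpr (fun i hi hi' => hne i hi hi')
  refine soloBlind_hgood_one hgood hBS hxS hxB (Finset.union_subset hA₀B hA₁B) ?_
  rw [Finset.sum_union hd, hA₀s, hA₁s]
  abel

/-- Representations of `x` and of `y` with `x + y + h p + h q = τ + τ` meet, for H-good `τ`. -/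
theorem soloBlind_reps_meet_two {h : ι → G} {S B : Finset ι} {τ : G} (hgood : ∀ T ⊆ S, ∑ i ∈ T, h i ≠ τ + τ)
    (hBS : B ⊆ S) {p q : ι} (hpS : p ∈ S) (hqS : q ∈ S) (hpB : p ∉ B) (hqB : q ∉ B) (hpq : p ≠ q)
    {x y : G} (e : x + y + h p + h q = τ + τ) {A A' : Finset ι}
    (hA : A ∈ soloBlindSeqRepAll h B x) (hA' : A' ∈ soloBlindSeqRepAll h B y) : ∃ s ∈ A, s ∈ A' := by
  obtain ⟨hAB, hAs⟩ := soloBlind_mem_seqRepAll.mp hA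
  obtain ⟨hA'B, hA's⟩ := soloBlind_mem_seqRepAll.mp hA'
  by_contra hne
  push Not at hne
  have hd : Disjoint A A' := Finset.disjoint_left.mpr (fun i hi hi' => hne i hi hi')
  refine soloBlind_hgood_two hgood hBS hpS hqS hpB hqB hpq (Finset.union_subset hAB hA'B) ?_
  rw [Finset.sum_union hd, hAs, hA's]
  exact e

omit [DecidableEq ι] [DecidableEq G] in
/-- A one-element representation through a given index is that singleton. -/
theorem soloBlind_singleton_of_card_one {h : ι → G} {A : Finset ι} {x : G} (hAs : ∑ i ∈ A, h i = x)
    (h1 : A.card = 1) {s : ι} (hs : s ∈ A) : A = {s} ∧ h s = x := by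
  obtain ⟨s', rfl⟩ := Finset.card_eq_one.mp h1
  rw [Finset.mem_singleton] at hs
  subst hs
  rw [Finset.sum_singleton] at hAs
  exact ⟨rfl, hAs⟩

omit [DecidableEq G] in
/-- A two-element representation through a given index: the other index and its value. -/
theorem soloBlind_pair_of_card_two' {h : ι → G} {A : Finset ι} {x : G} (hAs : ∑ i ∈ A, h i = x)
    (h2 : A.card = 2) {s : ι} (hs : s ∈ A) : ∃ v, v ≠ s ∧ v ∈ A ∧ (∀ w ∈ A, w ≠ s → w = v) ∧ h v = x - h s := by
  obtain ⟨a, b, hab, rfl⟩ := Finset.card_eq_two.mp h2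
  rw [Finset.sum_pair hab] at hAs
  rcases Finset.mem_insert.mp hs with rfl | hs
  · refine ⟨b, hab.symm, by simp, ?_, ?_⟩
    · intro w hw hws
      rcases Finset.mem_insert.mp hw with rfl | hw
      · exact absurd rfl hws
      · exact Finset.mem_singleton.mp hw
    · rw [← hAs]; abel
  · rw [Finset.mem_singleton] at hs
    subst hs
    refine ⟨a, hab, by simp, ?_, ?_⟩
    · intro w hw hws
      rcases Finset.mem_insert.mp hw with rfl | hw
      · rfl
      · exact absurd (Finset.mem_singleton.mp hw) hws
    · rw [← hAs]; abel

/-- CONJECTURE E AT CORANK TWO, branch `|A₀| ≥ 2` (after the two deletions). -/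
theorem soloBlind_conjE_corank_two_main (three : ∀ g : G, g + g + g = 0) {h : ι → G} {B : Finset ι} {p q : ι}
    (hpB : p ∉ B) (hqB : q ∉ B) (hpq : p ≠ q)
    (hdist : ∀ A ⊆ B, ∀ A' ⊆ B, ∑ i ∈ A, h i = ∑ i ∈ A', h i → A = A')
    (zsf : ∀ T ⊆ insert q (insert p B), T.Nonempty → ∑ i ∈ T, h i ≠ 0) {τ : G}
    (hgood : ∀ T ⊆ insert q (insert p B), ∑ i ∈ T, h i ≠ τ + τ) {A₀ : Finset ι}
    (hA₀ : A₀ ∈ soloBlindSeqRepAll h B τ) (n0ge : 2 ≤ A₀.card) :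
    soloBlindMass h B τ + 1 / 2 * soloBlindMass h B (τ - h p) +
      1 / 2 * (soloBlindMass h B (τ - h q) + 1 / 2 * soloBlindMass h B (τ - h q - h p)) ≤ 1 / 2 := by
  -- bookkeeping
  have hqS : q ∈ insert q (insert p B) := Finset.mem_insert_self q _
  have hpS : p ∈ insert q (insert p B) := Finset.mem_insert_of_mem (Finset.mem_insert_self p B)
  have hBS : B ⊆ insert q (insert p B) := (Finset.subset_insert p B).trans (Finset.subset_insert q _)
  have m1 := soloBlind_mass_le_one_of_sumDistinct hdist (τ - h p)
  have m2 := soloBlind_mass_le_one_of_sumDistinct hdist (τ - h q)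
  have m3 := soloBlind_mass_le_one_of_sumDistinct hdist (τ - h q - h p)
  have z0 := soloBlind_mass_nonneg h B τ
  have z1 := soloBlind_mass_nonneg h B (τ - h p)
  have z2 := soloBlind_mass_nonneg h B (τ - h q)
  have z3 := soloBlind_mass_nonneg h B (τ - h q - h p)
  have rep : ∀ {x : G} {A : Finset ι}, A ∈ soloBlindSeqRepAll h B x → A ⊆ B ∧ ∑ i ∈ A, h i = x :=
    fun hA => soloBlind_mem_seqRepAll.mp hA
  have e03 : τ + (τ - h q - h p) + h p + h q = τ + τ := by abel
  have e12 : τ - h p + (τ - h q) + h p + h q = τ + τ := by abel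
  obtain ⟨hA₀B, hA₀s⟩ := rep hA₀
  have m0' := soloBlind_mass_le_pow_of_rep hdist hA₀ n0ge
  norm_num at m0'
  -- `A₃`, when present, meets `A₀`, hence is nonempty
  have n3 : ∀ A₃ ∈ soloBlindSeqRepAll h B (τ - h q - h p), 1 ≤ A₃.card := by
    intro A₃ hA₃
    obtain ⟨w, -, hw⟩ := soloBlind_reps_meet_two hgood hBS hpS hqS hpB hqB hpq e03 hA₀ hA₃
    exact Finset.card_pos.mpr ⟨w, hw⟩
  -- kill K-c (and its mirror): `A₀ = {s, v}`, `A_C = {s}` (`C = p` or `q`), `A₃` present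
  have Kc : ∀ {x y : ι}, x ∈ insert q (insert p B) → y ∈ insert q (insert p B) → x ∉ B → y ∉ B →
      τ - h q - h p = τ - h y - h x →
      ∀ A₁ ∈ soloBlindSeqRepAll h B (τ - h x), ∀ A₃ ∈ soloBlindSeqRepAll h B (τ - h q - h p),
      A₀.card = 2 → A₁.card = 1 → False := by
    intro x y hxS hyS hxB hyB exy A₁ hA₁ A₃ hA₃ n02 n11
    obtain ⟨hA₁B, hA₁s⟩ := rep hA₁
    obtain ⟨hA₃B, hA₃s⟩ := rep hA₃
    obtain ⟨s, hs₀, hs₁⟩ := soloBlind_reps_meet_one hgood hBS hxS hxB hA₀ hA₁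
    obtain ⟨-, hs⟩ := soloBlind_singleton_of_card_one hA₁s n11 hs₁
    obtain ⟨v, hvs, hv₀, hvu, hv⟩ := soloBlind_pair_of_card_two' hA₀s n02 hs₀
    by_cases hs₃ : s ∈ A₃
    · refine soloBlind_kill_one zsf hBS hyS hyB ((Finset.erase_subset s A₃).trans hA₃B) ?_
      rw [Finset.sum_erase_eq_sub hs₃, hA₃s, exy, hs]
      abel
    · obtain ⟨w, hw₀, hw₃⟩ := soloBlind_reps_meet_two hgood hBS hpS hqS hpB hqB hpq e03 hA₀ hA₃
      have hws : w ≠ s := fun e => hs₃ (e ▸ hw₃)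
      have hwv : w = v := hvu w hw₀ hws
      subst hwv
      have hs' : s ∉ A₃.erase w := fun h' => hs₃ (Finset.mem_of_mem_erase h')
      refine soloBlind_hgood_one hgood hBS hyS hyB
        (Finset.insert_subset (hA₀B hs₀) ((Finset.erase_subset w A₃).trans hA₃B)) ?_
      rw [Finset.sum_insert hs', Finset.sum_erase_eq_sub hw₃, hA₃s, exy, hv, hs]
      have t := three (h x)
      calc τ - h x + (τ - h y - h x - (τ - (τ - h x))) + h y = τ + τ - (h x + h x + h x) := by abel
        _ = τ + τ := by rw [t, sub_zero]
  -- kill K-b (and its mirror): `A₀ = {s, v}`, `A_x = {s}`, `A_y ∋ s` with `|A_y| ≥ 2`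
  have Kb : ∀ {x y : ι}, x ∈ insert q (insert p B) → y ∈ insert q (insert p B) → x ∉ B → y ∉ B → x ≠ y →
      ∀ A₁ ∈ soloBlindSeqRepAll h B (τ - h x), ∀ A₂ ∈ soloBlindSeqRepAll h B (τ - h y),
      ∀ s ∈ A₁, s ∈ A₂ → A₀.card = 2 → A₁.card = 1 → False := by
    intro x y hxS hyS hxB hyB hxy A₁ hA₁ A₂ hA₂ s hs₁ hs₂ n02 n11
    obtain ⟨hA₁B, hA₁s⟩ := rep hA₁
    obtain ⟨hA₂B, hA₂s⟩ := rep hA₂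
    obtain ⟨hA₁e, hs⟩ := soloBlind_singleton_of_card_one hA₁s n11 hs₁
    obtain ⟨s', hs'₀, hs'₁⟩ := soloBlind_reps_meet_one hgood hBS hxS hxB hA₀ hA₁
    have hss' : s' = s := by rw [hA₁e] at hs'₁; exact Finset.mem_singleton.mp hs'₁
    subst hss'
    obtain ⟨v, hvs, hv₀, -, hv⟩ := soloBlind_pair_of_card_two' hA₀s n02 hs'₀
    by_cases hv₂ : v ∈ A₂
    · have hv' : v ∈ A₂.erase s' := Finset.mem_erase.mpr ⟨hvs, hv₂⟩
      refine soloBlind_kill_one zsf hBS hyS hyB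
        (((Finset.erase_subset v _).trans (Finset.erase_subset s' A₂)).trans hA₂B) ?_
      rw [Finset.sum_erase_eq_sub hv', Finset.sum_erase_eq_sub hs₂, hA₂s, hv, hs]
      abel
    · have hv' : v ∉ A₂.erase s' := fun h' => hv₂ (Finset.mem_of_mem_erase h')
      refine soloBlind_kill_two zsf hBS hxS hyS hxB hyB hxy
        (Finset.insert_subset (hA₀B hv₀) ((Finset.erase_subset s' A₂).trans hA₂B)) ?_
      rw [Finset.sum_insert hv', Finset.sum_erase_eq_sub hs₂, hA₂s, hv, hs]
      have t := three (h x)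
      calc τ - (τ - h x) + (τ - h y - (τ - h x)) + h x + h y = h x + h x + h x := by abel
        _ = 0 := t
  -- the case analysis
  rcases (soloBlindSeqRepAll h B (τ - h p)).eq_empty_or_nonempty with hR1 | ⟨A₁, hA₁⟩
  · -- (D1) `A₁` absent
    rw [soloBlind_mass_eq_zero_of_repAll_eq_empty hR1]
    rcases (soloBlindSeqRepAll h B (τ - h q)).eq_empty_or_nonempty with hR2 | ⟨A₂, hA₂⟩
    · rw [soloBlind_mass_eq_zero_of_repAll_eq_empty hR2]
      rcases (soloBlindSeqRepAll h B (τ - h q - h p)).eq_empty_or_nonempty with hR3 | ⟨A₃, hA₃⟩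
      · rw [soloBlind_mass_eq_zero_of_repAll_eq_empty hR3]
        linarith
      · have m3' := soloBlind_mass_le_pow_of_rep hdist hA₃ (n3 A₃ hA₃)
        rw [pow_one] at m3'
        linarith
    · obtain ⟨hA₂B, hA₂s⟩ := rep hA₂
      rcases Nat.eq_zero_or_pos A₂.card with n20 | n2pos
      · exfalso
        rw [Finset.card_eq_zero] at n20
        rw [n20, Finset.sum_empty] at hA₂s
        refine soloBlind_hgood_one hgood hBS hqS hqB hA₀B ?_
        rw [hA₀s, (sub_eq_zero.mp hA₂s.symm : τ = h q)]
      have m2' := soloBlind_mass_le_pow_of_rep hdist hA₂ n2pos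
      rw [pow_one] at m2'
      rcases (soloBlindSeqRepAll h B (τ - h q - h p)).eq_empty_or_nonempty with hR3 | ⟨A₃, hA₃⟩
      · rw [soloBlind_mass_eq_zero_of_repAll_eq_empty hR3]
        linarith
      · have m3' := soloBlind_mass_le_pow_of_rep hdist hA₃ (n3 A₃ hA₃)
        rw [pow_one] at m3'
        rcases Nat.lt_or_ge A₀.card 3 with n0lt | n0ge3
        · rcases Nat.lt_or_ge A₂.card 2 with n2lt | n2ge
          · -- (K-c') `A₀ = {s, v}`, `A₂ = {s}`, `A₃` present
            exfalso
            exact Kc hqS hpS hqB hpB (by abel) A₂ hA₂ A₃ hA₃ (by omega) (by omega)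
          · have m2'' := soloBlind_mass_le_pow_of_rep hdist hA₂ n2ge
            norm_num at m2''
            linarith
        · have m0'' := soloBlind_mass_le_pow_of_rep hdist hA₀ n0ge3
          norm_num at m0''
          linarith
  · -- (D2) `A₁` present
    obtain ⟨hA₁B, hA₁s⟩ := rep hA₁
    rcases Nat.eq_zero_or_pos A₁.card with n10 | n1pos
    · exfalso
      rw [Finset.card_eq_zero] at n10
      rw [n10, Finset.sum_empty] at hA₁s
      refine soloBlind_hgood_one hgood hBS hpS hpB hA₀B ?_
      rw [hA₀s, (sub_eq_zero.mp hA₁s.symm : τ = h p)]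
    have m1' := soloBlind_mass_le_pow_of_rep hdist hA₁ n1pos
    rw [pow_one] at m1'
    rcases (soloBlindSeqRepAll h B (τ - h q)).eq_empty_or_nonempty with hR2 | ⟨A₂, hA₂⟩
    · -- (E1) `A₂` absent
      rw [soloBlind_mass_eq_zero_of_repAll_eq_empty hR2]
      rcases (soloBlindSeqRepAll h B (τ - h q - h p)).eq_empty_or_nonempty with hR3 | ⟨A₃, hA₃⟩
      · rw [soloBlind_mass_eq_zero_of_repAll_eq_empty hR3]
        linarith
      · have m3' := soloBlind_mass_le_pow_of_rep hdist hA₃ (n3 A₃ hA₃)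
        rw [pow_one] at m3'
        rcases Nat.lt_or_ge A₀.card 3 with n0lt | n0ge3
        · rcases Nat.lt_or_ge A₁.card 2 with n1lt | n1ge
          · -- (K-c) `A₀ = {s, v}`, `A₁ = {s}`, `A₃` present
            exfalso
            exact Kc hpS hqS hpB hqB rfl A₁ hA₁ A₃ hA₃ (by omega) (by omega)
          · have m1'' := soloBlind_mass_le_pow_of_rep hdist hA₁ n1ge
            norm_num at m1''
            linarith
        · have m0'' := soloBlind_mass_le_pow_of_rep hdist hA₀ n0ge3
          norm_num at m0''
          linarith
    · -- (E2) `A₂` present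
      obtain ⟨hA₂B, hA₂s⟩ := rep hA₂
      rcases Nat.eq_zero_or_pos A₂.card with n20 | n2pos
      · exfalso
        rw [Finset.card_eq_zero] at n20
        rw [n20, Finset.sum_empty] at hA₂s
        refine soloBlind_hgood_one hgood hBS hqS hqB hA₀B ?_
        rw [hA₀s, (sub_eq_zero.mp hA₂s.symm : τ = h q)]
      have m2' := soloBlind_mass_le_pow_of_rep hdist hA₂ n2pos
      rw [pow_one] at m2'
      obtain ⟨s, hs₁, hs₂⟩ := soloBlind_reps_meet_two hgood hBS hpS hqS hpB hqB hpq e12 hA₁ hA₂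
      rcases (soloBlindSeqRepAll h B (τ - h q - h p)).eq_empty_or_nonempty with hR3 | ⟨A₃, hA₃⟩
      · -- (F1) `A₃` absent
        rw [soloBlind_mass_eq_zero_of_repAll_eq_empty hR3]
        rcases Nat.lt_or_ge A₁.card 2 with n1lt | n1ge
        · rcases Nat.lt_or_ge A₂.card 2 with n2lt | n2ge
          · -- (K-a) `A₁ = A₂ = {s}`: `a = b`, and `(A₀ \ s) + p + q` is a zero-sum
            exfalso
            obtain ⟨hA₁e, hsa⟩ := soloBlind_singleton_of_card_one hA₁s (by omega) hs₁
            obtain ⟨-, hsb⟩ := soloBlind_singleton_of_card_one hA₂s (by omega) hs₂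
            obtain ⟨s', hs'₀, hs'₁⟩ := soloBlind_reps_meet_one hgood hBS hpS hpB hA₀ hA₁
            have hss' : s' = s := by rw [hA₁e] at hs'₁; exact Finset.mem_singleton.mp hs'₁
            subst hss'
            refine soloBlind_kill_two zsf hBS hpS hqS hpB hqB hpq ((Finset.erase_subset s' A₀).trans hA₀B) ?_
            rw [Finset.sum_erase_eq_sub hs'₀, hA₀s, hsa]
            have eab : h q = h p := by
              have := hsa.symm.trans hsb
              simpa using this.symm
            have t := three (h p)
            rw [eab]
            calc τ - (τ - h p) + h p + h p = h p + h p + h p := by abel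
              _ = 0 := t
          · have m2'' := soloBlind_mass_le_pow_of_rep hdist hA₂ n2ge
            norm_num at m2''
            rcases Nat.lt_or_ge A₀.card 3 with n0lt | n0ge3
            · -- (K-b)
              exfalso
              exact Kb hpS hqS hpB hqB hpq A₁ hA₁ A₂ hA₂ s hs₁ hs₂ (by omega) (by omega)
            · have m0'' := soloBlind_mass_le_pow_of_rep hdist hA₀ n0ge3
              norm_num at m0''
              linarith
        · have m1'' := soloBlind_mass_le_pow_of_rep hdist hA₁ n1ge
          norm_num at m1''
          rcases Nat.lt_or_ge A₂.card 2 with n2lt | n2ge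
          · rcases Nat.lt_or_ge A₀.card 3 with n0lt | n0ge3
            · -- (K-b')
              exfalso
              exact Kb hqS hpS hqB hpB (Ne.symm hpq) A₂ hA₂ A₁ hA₁ s hs₂ hs₁ (by omega) (by omega)
            · have m0'' := soloBlind_mass_le_pow_of_rep hdist hA₀ n0ge3
              norm_num at m0''
              linarith
          · have m2'' := soloBlind_mass_le_pow_of_rep hdist hA₂ n2ge
            norm_num at m2''
            linarith
      · -- (F2) all four representations present: rigidity
        obtain ⟨hA₃B, hA₃s⟩ := rep hA₃
        have e : ∑ i ∈ A₀, h i + ∑ i ∈ A₃, h i = ∑ i ∈ A₁, h i + ∑ i ∈ A₂, h i := by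
          rw [hA₀s, hA₃s, hA₁s, hA₂s]
          abel
        have e' : ∑ i ∈ A₀, h i + ∑ i ∈ A₃, h i = ∑ i ∈ A₂, h i + ∑ i ∈ A₁, h i := by rw [e, add_comm]
        obtain ⟨e₀, he₀, he₃⟩ := soloBlind_reps_meet_two hgood hBS hpS hqS hpB hqB hpq e03 hA₀ hA₃
        obtain ⟨he₁, he₂⟩ := soloBlind_rep_rigidity_inter three hdist hA₀B hA₁B hA₂B hA₃B e he₀ he₃
        -- `A₁ ⊄ A₃` and `A₂ ⊄ A₃` (antichain), witnesses `x`, `u`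
        have hx : ∃ x ∈ A₁, x ∉ A₃ := by
          by_contra hne
          push Not at hne
          refine soloBlind_kill_one zsf hBS hqS hqB (Finset.sdiff_subset.trans hA₃B) (A := A₃ \ A₁) ?_
          rw [Finset.sum_sdiff_eq_sub (fun i hi => hne i hi), hA₃s, hA₁s]
          abel
        have hu : ∃ u ∈ A₂, u ∉ A₃ := by
          by_contra hne
          push Not at hne
          refine soloBlind_kill_one zsf hBS hpS hpB (Finset.sdiff_subset.trans hA₃B) (A := A₃ \ A₂) ?_
          rw [Finset.sum_sdiff_eq_sub (fun i hi => hne i hi), hA₃s, hA₂s]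
          abel
        obtain ⟨x, hx₁, hx₃⟩ := hx
        obtain ⟨u, hu₂, hu₃⟩ := hu
        obtain ⟨hx₀, hx₂⟩ := soloBlind_rep_rigidity_mem three hdist hA₀B hA₁B hA₂B hA₃B e hx₁ hx₃
        obtain ⟨hu₀, hu₁⟩ := soloBlind_rep_rigidity_mem three hdist hA₀B hA₂B hA₁B hA₃B e' hu₂ hu₃
        have hex : e₀ ≠ x := fun h' => hx₃ (h' ▸ he₃)
        have heu : e₀ ≠ u := fun h' => hu₃ (h' ▸ he₃)
        have hxu : x ≠ u := fun h' => hu₁ (h' ▸ hx₁)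
        have c0 : 3 ≤ A₀.card := Finset.two_lt_card.mpr ⟨e₀, he₀, x, hx₀, u, hu₀, hex, heu, hxu⟩
        have c1 : 2 ≤ A₁.card := Finset.one_lt_card.mpr ⟨e₀, he₁, x, hx₁, hex⟩
        have c2 : 2 ≤ A₂.card := Finset.one_lt_card.mpr ⟨e₀, he₂, u, hu₂, heu⟩
        have m0'' := soloBlind_mass_le_pow_of_rep hdist hA₀ c0
        have m1'' := soloBlind_mass_le_pow_of_rep hdist hA₁ c1
        have m2'' := soloBlind_mass_le_pow_of_rep hdist hA₂ c2
        have m3' := soloBlind_mass_le_pow_of_rep hdist hA₃ (n3 A₃ hA₃)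
        norm_num at m0'' m1'' m2''
        rw [pow_one] at m3'
        linarith

end Summit.MatrixMultiplication.MatrixMultiplication.Theorems
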